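import Literature.NumberTheory.Rogawski1990.KottwitzSignArchTorus         -- ★ FILE A (F0P3a-p05 (g11)): `kottwitzSign_conj_diagonal_eq_neg_one_iff_of_slots`, `kottwitzSign_diagonal_comp_perm`; brings ★ `ArchStableClassTorus` ⇒ ★ (V8)-sing per place
import Literature.NumberTheory.Automorphic.ArchLocalStableOrbitalSumTorus    -- ★ p839507 (F0P3a-p02): the per-place `Φ^st_w` at REGULAR torus points (`stableOrbitalIntegralRel_circleDiagonal_eq_sum`)
import HarnessLib

/-!
# The per-place stable orbital sum `Φ^st_w(diag z, a)` at an ARBITRARY torus point of `G_w = U(σ_w diag α)(ℂ)`, the TWO classes through the split-singular point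
# `γ₀ = diag(a,a,b)` of `U(2,1)` as an explicit PAIR with their Kottwitz signs, and the two-term (signed) formula (Rogawski 1990 §4.1 (4.1.2), §8.2 p. 117, Prop. 8.2.1 (d), §8.3 p. 122)

Topic `NumberTheory/Automorphic`; namespace `Literature.NumberTheory.Automorphic.UnitaryGroup`.  THEOREMS ONLY (no definition, no instance, no notation, no named fact, no `sorry`).
Cell `pub/hodgecm-mathlib`, ENGINE T1 (crux H413 = `stmt-HodgeConjecture-24833`); floor-1 preparation, count-neutral, under books rows #88 (ST-∞) ∕ #111 (S-d): road D2′∕ROAD-Sd, brick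
**«(J-sgn) SIGNED `Φ^st_∞` AT `γ₀`» FILE B (per place)** (F0P3a-p02 (g9)'s (o4); LEAD WORDS T8-34 (A) ∕ T8-35 (D) ∕ T8-38 (4), F0P3a-plan (g9); author F0P3a-p05 (g11)).  BY NAME over ★ B-p17 (g23)
`ArchLocalSplitSingularTorusClasses` (p838884: `exists_conj_circleDiagonal_perm_of_pos_iff`, `not_exists_conj_circleDiagonal_swap_neg_swap_pos`), ★ `ArchLocalSingularTorusClassesPlace` (p839558:
`conjClasses_stable_circleDiagonal_eq_range_of_conj`, `finite_…_of_conj`), ★ F0P3a-p02 `ArchLocalRegularTorusClasses` (docking `mem_archLocal_diagonal_iff_mem_unitaryGroupOfForm`,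
`re_embedding_ne_zero`, `circleDiagonal_mem_of_iff`), ★ `AdelicWeightedOrbitalEulerG2` (`classOrbitalIntegral_classWeight_mul`) and ★ FILE A `KottwitzSignArchTorus`.

WHAT IS PROVED (per place `w`; carrier ★ `stableOrbitalIntegralRel (G := archLocal L N (diagonal α) w) (IsStablyConj (starRingEnd ℂ) ((diagonal α).map w.1.embedding))`, LETTER #4 §5's `Φ^st_w`).
* §1 (any `N`, ANY `z`) **`stableOrbitalIntegralRel_circleDiagonal_eq_sum_of_conj`** — `Φ^st_w(diag z, a) = Σ_{q ∈ univ.image (σ ↦ ⟦diag(z∘σ)⟧)} Φ(q, a)` (the regular case is ★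
  `stableOrbitalIntegralRel_circleDiagonal_eq_sum`), and its class-weighted form **`stableOrbitalIntegralRel_classWeight_mul_circleDiagonal_eq_sum_of_conj`** (`Σ w(q)·Φ(q, a)`).
* §2 (`N = 3`; a realisation `U` of `U(diag e)(ℂ)`, `e_i ≠ 0`; `z` two-valued with singular slot `k`; slots `ip`, `im` with `0 < e ip`, `e im < 0`) **`mk_circleDiagonal_comp_eq_or`** (every relabelled
  point is conjugate IN `U` to `diag(z ∘ swap k ip)` or to `diag(z ∘ swap k im)`), **`mk_circleDiagonal_comp_swap_ne`** (these two are NOT conjugate), **`image_univ_mk_circleDiagonal_comp_eq_pair`**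
  (the class list IS this pair); docked at the place: **`image_univ_mk_circleDiagonal_comp_eq_pair_place`**, and the TWO-TERM formulas **`stableOrbitalIntegralRel_circleDiagonal_eq_add`**
  (`Φ^st_w(diag z, a) = Φ(C₊, a) + Φ(C₋, a)`) ∕ **`stableOrbitalIntegralRel_classWeight_mul_circleDiagonal_eq_add`** (`Φ^st_w(diag z, (w∘⟦·⟧)·a) = w(C₊)Φ(C₊, a) + w(C₋)Φ(C₋, a)`).
* §3 THE SIGNS OF THE TWO CLASSES (`j₃` the third slot): **`kottwitzSign_circleDiagonal_comp_swap_pos_eq_neg_one_iff`** (`e(diag(z ∘ swap k ip)) = −1 ↔ e j₃ < 0`) and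
  **`kottwitzSign_circleDiagonal_comp_swap_neg_eq_neg_one_iff`** (`e(diag(z ∘ swap k im)) = −1 ↔ 0 < e j₃`): at a `(2,1)` place (`0 < e j₃`) `C₊ = ⟦γ₀⟧` has `e = +1` and `C₋ = ⟦γ₀′⟧` has
  `e = −1`, so the SIGNED two-term formula reads «`Φ(γ₀, f) − Φ(γ₀′, f)`»; at a `(1,2)` place the roles swap.
* §4 THE WEIGHT INSTANTIATED: `kottwitzSign_coe_out_mk_archLocal` (`e_w` is a class function on `G_w`, ★ `kottwitzSign_units_conj`) and the ONE-HEAD signed formulas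
  **`stableOrbitalIntegralRel_kottwitzSign_mul_circleDiagonal_eq_sub`** (`(2,1)`-type place: `Φ^st_w(diag z, e_w·a) = Φ(C₊, a) − Φ(C₋, a)`) ∕ **`…_eq_sub'`** (`(1,2)`-type: `Φ(C₋, a) − Φ(C₊, a)`).
HONEST LABEL: HC_CM is proved only modulo the printed citations until rung 0 closes; this file is class book-keeping and pays nothing by itself.

## References
* [Rogawski1990] J. D. Rogawski, *Automorphic Representations of Unitary Groups in Three Variables*, Ann. of Math. Stud. 123 (1990): §4.1 (4.1.1)–(4.1.2) pp. 39–40, §3.8 Prop. 3.8.1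
  pp. 30–32, §8.2 p. 117 («`e(γ₀) = 1, e(γ₀′) = −1`»), Prop. 8.2.1 (d) p. 118, §8.3 p. 122 (two classes through the singular point of the compact Cartan of `U(2,1)`).
* [HornJohnson2013] R. A. Horn, C. R. Johnson, *Matrix Analysis*, 2nd ed. (2013), §4.5 Thm. 4.5.8 (Sylvester's law of inertia).
-/

set_option autoImplicit false

noncomputable section

open MeasureTheory Matrix Equiv Finset NumberField NumberField.InfinitePlace
open Literature.LinearAlgebra.Matrix Literature.NumberTheory.Rogawski1990
open scoped MatrixGroups ComplexConjugate

namespace Literature.NumberTheory.Automorphic.UnitaryGroup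

/-! ## §1 `Φ^st_w(diag z, a)` as a finite sum at an ARBITRARY torus point -/

section AnyPoint

variable (L : Type) [Field L] (N : ℕ) (α : Fin N → L) (w : {w : InfinitePlace L // IsComplex w})
variable [∀ γ : archLocal L N (diagonal α) w, MeasurableSpace (archLocal L N (diagonal α) w ⧸ Subgroup.centralizer ({γ} : Set (archLocal L N (diagonal α) w)))]

open scoped Classical in
/-- **`Φ^st_w(diag z, a) = Σ_{q ∈ univ.image (σ ↦ ⟦diag(z∘σ)⟧)} Φ(q, a)` AT AN ARBITRARY TORUS POINT** (`z` ANY — the split-singular `γ₀` included): ★ B-p17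
`conjClasses_stable_circleDiagonal_eq_range_of_conj` + `finite_…_of_conj` + ★ `stableOrbitalIntegralRel_eq_sum`; any family `m`, any `a` (regular case ★
`stableOrbitalIntegralRel_circleDiagonal_eq_sum`). [cite: Rogawski1990, §4.1 (4.1.1) p. 39; §8.2 Prop. 8.2.1 p. 118] -/
theorem stableOrbitalIntegralRel_circleDiagonal_eq_sum_of_conj (hα : ∀ i, α i ≠ 0) (hreal : ∀ i, (w.1.embedding (α i)).im = 0) (z : Fin N → Circle)
    (m : OrbitalMeasureFamily (archLocal L N (diagonal α) w)) (a : archLocal L N (diagonal α) w → ℂ) :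
    stableOrbitalIntegralRel (G := archLocal L N (diagonal α) w) (IsStablyConj (starRingEnd ℂ) ((diagonal α).map w.1.embedding)) m a
        ⟨circleDiagonal N z, circleDiagonal_mem_archLocal_diagonal L N α w z⟩ =
      ∑ q ∈ Finset.univ.image (fun σ : Perm (Fin N) =>
          ConjClasses.mk (⟨circleDiagonal N (z ∘ σ), circleDiagonal_mem_archLocal_diagonal L N α w (z ∘ σ)⟩ : archLocal L N (diagonal α) w)),
        classOrbitalIntegral m a q := by
  rw [stableOrbitalIntegralRel_eq_sum m a (finite_conjClasses_stable_circleDiagonal_of_conj L N α w hα hreal z)]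
  refine Finset.sum_congr ?_ fun _ _ => rfl
  apply Finset.coe_injective
  rw [Set.Finite.coe_toFinset]
  exact (conjClasses_stable_circleDiagonal_eq_range_of_conj L N α w hα hreal z).trans (by rw [Finset.coe_image, Finset.coe_univ, Set.image_univ])

open scoped Classical in
/-- The CLASS-WEIGHTED version at an arbitrary torus point: `Φ^st_w(diag z, (w∘⟦·⟧)·a) = Σ_{q} w(q) · Φ(q, a)` (★ `classOrbitalIntegral_classWeight_mul`) — the per-place SIGNED sum of (4.1.2)
for `w` the Kottwitz sign. [cite: Rogawski1990, §4.1 (4.1.2) pp. 39–40] -/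
theorem stableOrbitalIntegralRel_classWeight_mul_circleDiagonal_eq_sum_of_conj (hα : ∀ i, α i ≠ 0) (hreal : ∀ i, (w.1.embedding (α i)).im = 0)
    (z : Fin N → Circle) (wt : ConjClasses (archLocal L N (diagonal α) w) → ℂ)
    (m : OrbitalMeasureFamily (archLocal L N (diagonal α) w)) (a : archLocal L N (diagonal α) w → ℂ) :
    stableOrbitalIntegralRel (G := archLocal L N (diagonal α) w) (IsStablyConj (starRingEnd ℂ) ((diagonal α).map w.1.embedding)) m
        (fun x => wt (ConjClasses.mk x) * a x) ⟨circleDiagonal N z, circleDiagonal_mem_archLocal_diagonal L N α w z⟩ =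
      ∑ q ∈ Finset.univ.image (fun σ : Perm (Fin N) =>
          ConjClasses.mk (⟨circleDiagonal N (z ∘ σ), circleDiagonal_mem_archLocal_diagonal L N α w (z ∘ σ)⟩ : archLocal L N (diagonal α) w)),
        wt q * classOrbitalIntegral m a q := by
  rw [stableOrbitalIntegralRel_circleDiagonal_eq_sum_of_conj L N α w hα hreal z]
  exact Finset.sum_congr rfl fun q _ => classOrbitalIntegral_classWeight_mul m wt a q

end AnyPoint

/-! ## §2 `N = 3`: the two classes through the split-singular point, as an explicit pair -/

section Pair

variable (U : Subgroup (GL (Fin 3) ℂ)) {e : Fin 3 → ℝ}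

/-- Conjugacy classes of a subgroup, read on the ambient group. [folklore] -/
private theorem conjClasses_mk_eq_mk_iff_exists_coe_conj₃ {G : Type*} [Group G] {H : Subgroup G} (x y : H) :
    ConjClasses.mk x = ConjClasses.mk y ↔ ∃ g : H, (g : G) * (x : G) * (g : G)⁻¹ = y := by
  rw [ConjClasses.mk_eq_mk_iff_isConj, isConj_iff]
  constructor
  · rintro ⟨c, hc⟩
    exact ⟨c, by rw [← hc, Subgroup.coe_mul, Subgroup.coe_mul, Subgroup.coe_inv]⟩
  · rintro ⟨g, hg⟩
    exact ⟨g, Subtype.ext (by rw [Subgroup.coe_mul, Subgroup.coe_mul, Subgroup.coe_inv]; exact hg)⟩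

/-- **EVERY RELABELLED POINT IS ONE OF THE TWO**: in a realisation `U` of `U(diag e)(ℂ)` (`e_i ≠ 0`), for `z` two-valued with singular slot `k` and slots `ip`, `im` of positive ∕ negative weight,
`⟦diag(z ∘ ρ)⟧ = ⟦diag(z ∘ swap k ip)⟧` (if the slot `ρ⁻¹ k` now carrying `b = z k` is positive) or `= ⟦diag(z ∘ swap k im)⟧` (if negative) — ★ B-p17 `exists_conj_circleDiagonal_perm_of_pos_iff`.
[cite: Rogawski1990, §8.3 p. 122 (§8.2 Prop. 8.2.1 p. 118); §3.8 Prop. 3.8.1 pp. 30–32] [cite: HornJohnson2013, §4.5 Thm 4.5.8] -/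
theorem mk_circleDiagonal_comp_eq_or (hU : ∀ g : GL (Fin 3) ℂ, g ∈ U ↔ g ∈ unitaryGroupOfForm (starRingEnd ℂ) (diagonal fun i => (e i : ℂ)))
    (he : ∀ i, e i ≠ 0) {z : Fin 3 → Circle} {k : Fin 3} (hk : ∀ j, z j = z k ↔ j = k) (hzz : ∀ i j, i ≠ k → j ≠ k → z i = z j)
    {ip im : Fin 3} (hip : 0 < e ip) (him : e im < 0) (ρ : Perm (Fin 3)) :
    ConjClasses.mk (⟨circleDiagonal 3 (z ∘ ρ), circleDiagonal_mem_of_iff 3 U hU (z ∘ ρ)⟩ : U) =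
        ConjClasses.mk (⟨circleDiagonal 3 (z ∘ Equiv.swap k ip), circleDiagonal_mem_of_iff 3 U hU _⟩ : U) ∨
      ConjClasses.mk (⟨circleDiagonal 3 (z ∘ ρ), circleDiagonal_mem_of_iff 3 U hU (z ∘ ρ)⟩ : U) =
        ConjClasses.mk (⟨circleDiagonal 3 (z ∘ Equiv.swap k im), circleDiagonal_mem_of_iff 3 U hU _⟩ : U) := by
  obtain rfl : U = unitaryGroupOfForm (starRingEnd ℂ) (diagonal fun i => (e i : ℂ)) := Subgroup.ext hU
  -- `z ∘ ρ = fun i => z ((ρ⁻¹).symm i)`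
  have hρ : (z ∘ ρ) = fun i => z ((ρ⁻¹ : Perm (Fin 3)).symm i) := by
    funext i; simp only [Function.comp_apply, Perm.inv_def, Equiv.symm_symm]
  rcases lt_or_gt_of_ne (he ((ρ⁻¹ : Perm (Fin 3)) k)) with hneg | hpos
  · refine Or.inr ((conjClasses_mk_eq_mk_iff_exists_coe_conj₃ _ _).mpr ?_)
    obtain ⟨g, hg⟩ := exists_conj_circleDiagonal_perm_of_pos_iff he hk hzz ρ⁻¹ (Equiv.swap k im)
      (by rw [Equiv.swap_apply_left]; exact ⟨fun h => (lt_irrefl _ (hneg.trans h)).elim, fun h => (lt_irrefl _ (him.trans h)).elim⟩)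
    refine ⟨g, ?_⟩
    rw [hρ]
    exact hg
  · refine Or.inl ((conjClasses_mk_eq_mk_iff_exists_coe_conj₃ _ _).mpr ?_)
    obtain ⟨g, hg⟩ := exists_conj_circleDiagonal_perm_of_pos_iff he hk hzz ρ⁻¹ (Equiv.swap k ip)
      (by rw [Equiv.swap_apply_left]; exact ⟨fun _ => hip, fun _ => hpos⟩)
    refine ⟨g, ?_⟩
    rw [hρ]
    exact hg

/-- **THE TWO ARE DISTINCT**: `⟦diag(z ∘ swap k ip)⟧ ≠ ⟦diag(z ∘ swap k im)⟧` in `U` («`b` over a positive slot» vs «`b` over a negative slot» — ★ B-p17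
`not_exists_conj_circleDiagonal_swap_neg_swap_pos`, Sylvester on the singleton `b`-fibre). [cite: Rogawski1990, §8.3 p. 122 (§8.2 Prop. 8.2.1 p. 118)] [cite: HornJohnson2013, §4.5 Thm 4.5.8] -/
theorem mk_circleDiagonal_comp_swap_ne (hU : ∀ g : GL (Fin 3) ℂ, g ∈ U ↔ g ∈ unitaryGroupOfForm (starRingEnd ℂ) (diagonal fun i => (e i : ℂ)))
    {z : Fin 3 → Circle} {k : Fin 3} (hk : ∀ j, z j = z k ↔ j = k) {ip im : Fin 3} (hip : 0 < e ip) (him : e im < 0) :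
    ConjClasses.mk (⟨circleDiagonal 3 (z ∘ Equiv.swap k ip), circleDiagonal_mem_of_iff 3 U hU _⟩ : U) ≠
      ConjClasses.mk (⟨circleDiagonal 3 (z ∘ Equiv.swap k im), circleDiagonal_mem_of_iff 3 U hU _⟩ : U) := by
  obtain rfl : U = unitaryGroupOfForm (starRingEnd ℂ) (diagonal fun i => (e i : ℂ)) := Subgroup.ext hU
  intro h
  apply not_exists_conj_circleDiagonal_swap_neg_swap_pos (e := e) hk hip him
  obtain ⟨g, hg⟩ := (conjClasses_mk_eq_mk_iff_exists_coe_conj₃ _ _).mp h.symm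
  exact ⟨g, hg⟩

open scoped Classical in
/-- **THE CLASS LIST THROUGH THE SPLIT-SINGULAR POINT IS THE PAIR `{⟦diag(z ∘ swap k ip)⟧, ⟦diag(z ∘ swap k im)⟧}`** (explicit form of ★ B-p17's count
`ncard_conjClasses_circleDiagonal_perm_eq_two`). [cite: Rogawski1990, §8.3 p. 122 (§8.2 Prop. 8.2.1 p. 118); §4.1 (4.1.1) p. 39] -/
theorem image_univ_mk_circleDiagonal_comp_eq_pair (hU : ∀ g : GL (Fin 3) ℂ, g ∈ U ↔ g ∈ unitaryGroupOfForm (starRingEnd ℂ) (diagonal fun i => (e i : ℂ)))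
    (he : ∀ i, e i ≠ 0) {z : Fin 3 → Circle} {k : Fin 3} (hk : ∀ j, z j = z k ↔ j = k) (hzz : ∀ i j, i ≠ k → j ≠ k → z i = z j)
    {ip im : Fin 3} (hip : 0 < e ip) (him : e im < 0) :
    Finset.univ.image (fun ρ : Perm (Fin 3) => ConjClasses.mk (⟨circleDiagonal 3 (z ∘ ρ), circleDiagonal_mem_of_iff 3 U hU (z ∘ ρ)⟩ : U)) =
      {ConjClasses.mk (⟨circleDiagonal 3 (z ∘ Equiv.swap k ip), circleDiagonal_mem_of_iff 3 U hU _⟩ : U),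
        ConjClasses.mk (⟨circleDiagonal 3 (z ∘ Equiv.swap k im), circleDiagonal_mem_of_iff 3 U hU _⟩ : U)} := by
  ext q
  simp only [Finset.mem_image, Finset.mem_univ, true_and, Finset.mem_insert, Finset.mem_singleton]
  constructor
  · rintro ⟨ρ, rfl⟩
    exact mk_circleDiagonal_comp_eq_or U hU he hk hzz hip him ρ
  · rintro (rfl | rfl)
    · exact ⟨Equiv.swap k ip, rfl⟩
    · exact ⟨Equiv.swap k im, rfl⟩

end Pair

/-! ### Docking at the place `w`: `G_w = archLocal L 3 (diagonal α) w`, `e = re ∘ σ_w ∘ α` -/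

section Place

variable (L : Type) [Field L] (α : Fin 3 → L) (w : {w : InfinitePlace L // IsComplex w})

open scoped Classical in
/-- **THE PAIR AT THE PLACE `w`** (signature `(2,1)` or `(1,2)`: a slot `ip` of positive and a slot `im` of negative weight `re σ_w(α_i)`): the classes of `G_w` in the stable class of the
split-singular torus point `diag(z)` are exactly `⟦diag(z ∘ swap k ip)⟧` and `⟦diag(z ∘ swap k im)⟧`, distinct. [cite: Rogawski1990, §8.3 p. 122 (§8.2 Prop. 8.2.1 p. 118)] -/
theorem image_univ_mk_circleDiagonal_comp_eq_pair_place (hα : ∀ i, α i ≠ 0) (hreal : ∀ i, (w.1.embedding (α i)).im = 0)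
    {z : Fin 3 → Circle} {k : Fin 3} (hk : ∀ j, z j = z k ↔ j = k) (hzz : ∀ i j, i ≠ k → j ≠ k → z i = z j)
    {ip im : Fin 3} (hip : 0 < (w.1.embedding (α ip)).re) (him : (w.1.embedding (α im)).re < 0) :
    Finset.univ.image (fun ρ : Perm (Fin 3) =>
        ConjClasses.mk (⟨circleDiagonal 3 (z ∘ ρ), circleDiagonal_mem_archLocal_diagonal L 3 α w (z ∘ ρ)⟩ : archLocal L 3 (diagonal α) w)) =
      {ConjClasses.mk (⟨circleDiagonal 3 (z ∘ Equiv.swap k ip), circleDiagonal_mem_archLocal_diagonal L 3 α w _⟩ : archLocal L 3 (diagonal α) w),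
        ConjClasses.mk (⟨circleDiagonal 3 (z ∘ Equiv.swap k im), circleDiagonal_mem_archLocal_diagonal L 3 α w _⟩ : archLocal L 3 (diagonal α) w)} ∧
    ConjClasses.mk (⟨circleDiagonal 3 (z ∘ Equiv.swap k ip), circleDiagonal_mem_archLocal_diagonal L 3 α w _⟩ : archLocal L 3 (diagonal α) w) ≠
      ConjClasses.mk (⟨circleDiagonal 3 (z ∘ Equiv.swap k im), circleDiagonal_mem_archLocal_diagonal L 3 α w _⟩ : archLocal L 3 (diagonal α) w) :=
  ⟨image_univ_mk_circleDiagonal_comp_eq_pair (archLocal L 3 (diagonal α) w) (mem_archLocal_diagonal_iff_mem_unitaryGroupOfForm L 3 α w hreal)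
      (re_embedding_ne_zero L 3 α w hα hreal) hk hzz hip him,
    mk_circleDiagonal_comp_swap_ne (archLocal L 3 (diagonal α) w) (mem_archLocal_diagonal_iff_mem_unitaryGroupOfForm L 3 α w hreal) hk hip him⟩

variable [∀ γ : archLocal L 3 (diagonal α) w, MeasurableSpace (archLocal L 3 (diagonal α) w ⧸ Subgroup.centralizer ({γ} : Set (archLocal L 3 (diagonal α) w)))]

/-- **THE TWO-TERM FORMULA (unsigned)**: `Φ^st_w(diag z, a) = Φ(⟦diag(z ∘ swap k ip)⟧, a) + Φ(⟦diag(z ∘ swap k im)⟧, a)` at the split-singular torus point of an indefinite place — print's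
«`Φ(γ₀, f) + Φ(γ₀′, f)`» (the UNSTABLE `Φ^κ` of p. 117 up to sign conventions); any family `m`, any `a`. [cite: Rogawski1990, §4.1 (4.1.1) p. 39; §8.2 p. 117, Prop. 8.2.1 p. 118] -/
theorem stableOrbitalIntegralRel_circleDiagonal_eq_add (hα : ∀ i, α i ≠ 0) (hreal : ∀ i, (w.1.embedding (α i)).im = 0)
    {z : Fin 3 → Circle} {k : Fin 3} (hk : ∀ j, z j = z k ↔ j = k) (hzz : ∀ i j, i ≠ k → j ≠ k → z i = z j)
    {ip im : Fin 3} (hip : 0 < (w.1.embedding (α ip)).re) (him : (w.1.embedding (α im)).re < 0)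
    (m : OrbitalMeasureFamily (archLocal L 3 (diagonal α) w)) (a : archLocal L 3 (diagonal α) w → ℂ) :
    stableOrbitalIntegralRel (G := archLocal L 3 (diagonal α) w) (IsStablyConj (starRingEnd ℂ) ((diagonal α).map w.1.embedding)) m a
        ⟨circleDiagonal 3 z, circleDiagonal_mem_archLocal_diagonal L 3 α w z⟩ =
      classOrbitalIntegral m a (ConjClasses.mk (⟨circleDiagonal 3 (z ∘ Equiv.swap k ip), circleDiagonal_mem_archLocal_diagonal L 3 α w _⟩ : archLocal L 3 (diagonal α) w)) +
        classOrbitalIntegral m a (ConjClasses.mk (⟨circleDiagonal 3 (z ∘ Equiv.swap k im), circleDiagonal_mem_archLocal_diagonal L 3 α w _⟩ : archLocal L 3 (diagonal α) w)) := by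
  classical
  obtain ⟨hpair, hne⟩ := image_univ_mk_circleDiagonal_comp_eq_pair_place L α w hα hreal hk hzz hip him
  rw [stableOrbitalIntegralRel_circleDiagonal_eq_sum_of_conj L 3 α w hα hreal z m a, hpair, Finset.sum_pair hne]

/-- **THE TWO-TERM FORMULA, CLASS-WEIGHTED (the SIGNED one at `wt` = Kottwitz sign)**: `Φ^st_w(diag z, (wt∘⟦·⟧)·a) = wt(C₊)·Φ(C₊, a) + wt(C₋)·Φ(C₋, a)`,
`C₊ = ⟦diag(z ∘ swap k ip)⟧`, `C₋ = ⟦diag(z ∘ swap k im)⟧`; with §3 (`0 < e j₃`: `wt(C₊) = 1`, `wt(C₋) = −1`) this is print's SIGNED «`Φ(γ₀, f) − Φ(γ₀′, f)`» [Prop. 8.2.1 (d)].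
[cite: Rogawski1990, §4.1 (4.1.2) pp. 39–40; §8.2 p. 117, Prop. 8.2.1 (d) p. 118] -/
theorem stableOrbitalIntegralRel_classWeight_mul_circleDiagonal_eq_add (hα : ∀ i, α i ≠ 0) (hreal : ∀ i, (w.1.embedding (α i)).im = 0)
    {z : Fin 3 → Circle} {k : Fin 3} (hk : ∀ j, z j = z k ↔ j = k) (hzz : ∀ i j, i ≠ k → j ≠ k → z i = z j)
    {ip im : Fin 3} (hip : 0 < (w.1.embedding (α ip)).re) (him : (w.1.embedding (α im)).re < 0)
    (wt : ConjClasses (archLocal L 3 (diagonal α) w) → ℂ) (m : OrbitalMeasureFamily (archLocal L 3 (diagonal α) w)) (a : archLocal L 3 (diagonal α) w → ℂ) :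
    stableOrbitalIntegralRel (G := archLocal L 3 (diagonal α) w) (IsStablyConj (starRingEnd ℂ) ((diagonal α).map w.1.embedding)) m
        (fun x => wt (ConjClasses.mk x) * a x) ⟨circleDiagonal 3 z, circleDiagonal_mem_archLocal_diagonal L 3 α w z⟩ =
      wt (ConjClasses.mk (⟨circleDiagonal 3 (z ∘ Equiv.swap k ip), circleDiagonal_mem_archLocal_diagonal L 3 α w _⟩ : archLocal L 3 (diagonal α) w)) *
          classOrbitalIntegral m a (ConjClasses.mk (⟨circleDiagonal 3 (z ∘ Equiv.swap k ip), circleDiagonal_mem_archLocal_diagonal L 3 α w _⟩ : archLocal L 3 (diagonal α) w)) +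
        wt (ConjClasses.mk (⟨circleDiagonal 3 (z ∘ Equiv.swap k im), circleDiagonal_mem_archLocal_diagonal L 3 α w _⟩ : archLocal L 3 (diagonal α) w)) *
          classOrbitalIntegral m a (ConjClasses.mk (⟨circleDiagonal 3 (z ∘ Equiv.swap k im), circleDiagonal_mem_archLocal_diagonal L 3 α w _⟩ : archLocal L 3 (diagonal α) w)) := by
  classical
  obtain ⟨hpair, hne⟩ := image_univ_mk_circleDiagonal_comp_eq_pair_place L α w hα hreal hk hzz hip him
  rw [stableOrbitalIntegralRel_classWeight_mul_circleDiagonal_eq_sum_of_conj L 3 α w hα hreal z wt m a, hpair, Finset.sum_pair hne]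

/-! ## §3 The Kottwitz signs of the two classes -/

omit [∀ γ : archLocal L 3 (diagonal α) w, MeasurableSpace (archLocal L 3 (diagonal α) w ⧸ Subgroup.centralizer ({γ} : Set (archLocal L 3 (diagonal α) w)))] in
/-- After the relabelling `swap k i` the singular eigenvalue `b = z k` sits in slot `i` (and only there). [folklore] -/
private theorem comp_swap_apply_eq_iff {z : Fin 3 → Circle} {k : Fin 3} (hk : ∀ j, z j = z k ↔ j = k) (i m : Fin 3) :
    (z ∘ Equiv.swap k i) m = (z ∘ Equiv.swap k i) i ↔ m = i := by
  simp only [Function.comp_apply, Equiv.swap_apply_right]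
  rw [hk, Equiv.swap_apply_eq_iff, Equiv.swap_apply_left]

omit [∀ γ : archLocal L 3 (diagonal α) w, MeasurableSpace (archLocal L 3 (diagonal α) w ⧸ Subgroup.centralizer ({γ} : Set (archLocal L 3 (diagonal α) w)))] in
/-- Off the slot `i` the relabelled point `z ∘ swap k i` is constant. [folklore] -/
private theorem comp_swap_apply_eq_of_ne {z : Fin 3 → Circle} {k : Fin 3} (hzz : ∀ i j, i ≠ k → j ≠ k → z i = z j)
    (i m m' : Fin 3) (hm : m ≠ i) (hm' : m' ≠ i) : (z ∘ Equiv.swap k i) m = (z ∘ Equiv.swap k i) m' := by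
  simp only [Function.comp_apply]
  refine hzz _ _ ?_ ?_
  · rw [Ne, Equiv.swap_apply_eq_iff, Equiv.swap_apply_left]; exact hm
  · rw [Ne, Equiv.swap_apply_eq_iff, Equiv.swap_apply_left]; exact hm'

omit [∀ γ : archLocal L 3 (diagonal α) w, MeasurableSpace (archLocal L 3 (diagonal α) w ⧸ Subgroup.centralizer ({γ} : Set (archLocal L 3 (diagonal α) w)))] in
/-- **`e(C₊)`: the class with `b` over the POSITIVE slot `ip` has sign `−1` iff the THIRD weight is NEGATIVE** (`j₃ ∉ {ip, im}`; then the `a`-plane `⟨im, j₃⟩` is negative definite —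
signature `(1,2)`); so at a `(2,1)` place `e(C₊) = +1`: `C₊ = ⟦γ₀⟧`, centraliser `U(1,1) × U(1)` (★ FILE A `kottwitzSign_conj_diagonal_eq_neg_one_iff_of_slots`).
[cite: Rogawski1990, §8.2 p. 117; §4.1 (4.1.2) p. 39] -/
theorem kottwitzSign_circleDiagonal_comp_swap_pos_eq_neg_one_iff (hα : ∀ i, α i ≠ 0) (hreal : ∀ i, (w.1.embedding (α i)).im = 0)
    {z : Fin 3 → Circle} {k : Fin 3} (hk : ∀ j, z j = z k ↔ j = k) (hzz : ∀ i j, i ≠ k → j ≠ k → z i = z j)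
    {ip im j₃ : Fin 3} (hip : 0 < (w.1.embedding (α ip)).re) (him : (w.1.embedding (α im)).re < 0) (hj₃p : j₃ ≠ ip) (hj₃m : j₃ ≠ im) :
    kottwitzSign (starRingEnd ℂ) ((diagonal α).map w.1.embedding)
        ((circleDiagonal 3 (z ∘ Equiv.swap k ip) : GL (Fin 3) ℂ) : Matrix (Fin 3) (Fin 3) ℂ) = -1 ↔ (w.1.embedding (α j₃)).re < 0 := by
  have hpm : im ≠ ip := by rintro rfl; exact lt_irrefl _ (him.trans hip)
  have hne0 : ∀ i, w.1.embedding (α i) ≠ 0 := fun i => (map_ne_zero_iff _ (RingHom.injective _)).mpr (hα i)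
  have hs : ∀ m, ((z ∘ Equiv.swap k ip) m : ℂ) = ((z ∘ Equiv.swap k ip) ip : ℂ) ↔ m = ip := fun m =>
    ⟨fun h => (comp_swap_apply_eq_iff hk ip m).mp (Circle.ext h), fun h => by rw [h]⟩
  have hdd : ∀ m m', m ≠ ip → m' ≠ ip → ((z ∘ Equiv.swap k ip) m : ℂ) = ((z ∘ Equiv.swap k ip) m' : ℂ) := fun m m' hm hm' =>
    congrArg Subtype.val (comp_swap_apply_eq_of_ne hzz ip m m' hm hm')
  rw [coe_circleDiagonal, diagonal_map (map_zero _),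
    kottwitzSign_conj_diagonal_eq_neg_one_iff_of_slots (d := fun m => ((z ∘ Equiv.swap k ip) m : ℂ)) (t := fun i => w.1.embedding (α i))
      hs hdd hreal hne0 hpm hj₃p (Ne.symm hj₃m),
    Complex.mul_re, hreal im, hreal j₃, mul_zero, sub_zero]
  constructor
  · intro h
    by_contra hle
    push Not at hle
    nlinarith [mul_nonneg (neg_nonneg.mpr him.le) hle]
  · intro h
    exact mul_pos_of_neg_of_neg him h

omit [∀ γ : archLocal L 3 (diagonal α) w, MeasurableSpace (archLocal L 3 (diagonal α) w ⧸ Subgroup.centralizer ({γ} : Set (archLocal L 3 (diagonal α) w)))] in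
/-- **`e(C₋)`: the class with `b` over the NEGATIVE slot `im` has sign `−1` iff the THIRD weight is POSITIVE** (the `a`-plane `⟨ip, j₃⟩` is positive definite — signature `(2,1)`):
at a `(2,1)` place `e(C₋) = −1`: `C₋ = ⟦γ₀′⟧`, centraliser `U(2) × U(1)`, «`e(γ₀′) = −1`». [cite: Rogawski1990, §8.2 p. 117; §4.1 (4.1.2) p. 39] -/
theorem kottwitzSign_circleDiagonal_comp_swap_neg_eq_neg_one_iff (hα : ∀ i, α i ≠ 0) (hreal : ∀ i, (w.1.embedding (α i)).im = 0)
    {z : Fin 3 → Circle} {k : Fin 3} (hk : ∀ j, z j = z k ↔ j = k) (hzz : ∀ i j, i ≠ k → j ≠ k → z i = z j)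
    {ip im j₃ : Fin 3} (hip : 0 < (w.1.embedding (α ip)).re) (him : (w.1.embedding (α im)).re < 0) (hj₃p : j₃ ≠ ip) (hj₃m : j₃ ≠ im) :
    kottwitzSign (starRingEnd ℂ) ((diagonal α).map w.1.embedding)
        ((circleDiagonal 3 (z ∘ Equiv.swap k im) : GL (Fin 3) ℂ) : Matrix (Fin 3) (Fin 3) ℂ) = -1 ↔ 0 < (w.1.embedding (α j₃)).re := by
  have hpm : ip ≠ im := by rintro rfl; exact lt_irrefl _ (him.trans hip)
  have hne0 : ∀ i, w.1.embedding (α i) ≠ 0 := fun i => (map_ne_zero_iff _ (RingHom.injective _)).mpr (hα i)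
  have hs : ∀ m, ((z ∘ Equiv.swap k im) m : ℂ) = ((z ∘ Equiv.swap k im) im : ℂ) ↔ m = im := fun m =>
    ⟨fun h => (comp_swap_apply_eq_iff hk im m).mp (Circle.ext h), fun h => by rw [h]⟩
  have hdd : ∀ m m', m ≠ im → m' ≠ im → ((z ∘ Equiv.swap k im) m : ℂ) = ((z ∘ Equiv.swap k im) m' : ℂ) := fun m m' hm hm' =>
    congrArg Subtype.val (comp_swap_apply_eq_of_ne hzz im m m' hm hm')
  rw [coe_circleDiagonal, diagonal_map (map_zero _),
    kottwitzSign_conj_diagonal_eq_neg_one_iff_of_slots (d := fun m => ((z ∘ Equiv.swap k im) m : ℂ)) (t := fun i => w.1.embedding (α i))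
      hs hdd hreal hne0 hpm hj₃m (Ne.symm hj₃p),
    Complex.mul_re, hreal ip, hreal j₃, mul_zero, sub_zero]
  constructor
  · intro h
    by_contra hle
    push Not at hle
    nlinarith [mul_nonneg hip.le (neg_nonneg.mpr hle)]
  · intro h
    exact mul_pos hip h

/-! ## §4 The per-place Kottwitz class weight, instantiated: the SIGNED two-term formula as one head -/

omit [∀ γ : archLocal L 3 (diagonal α) w, MeasurableSpace (archLocal L 3 (diagonal α) w ⧸ Subgroup.centralizer ({γ} : Set (archLocal L 3 (diagonal α) w)))] in
/-- **`e_w` IS A CLASS FUNCTION ON `G_w`**: the matrix sign of a representative `out ⟦x⟧` of the class of `x ∈ G_w = U(σ_w diag α)(ℂ)` is the matrix sign of `x` (★ `kottwitzSign_units_conj`; the per-place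
twin of ★ `kottwitzSignLocal_mk` ∕ `kottwitzSignArch_mk`). [cite: Rogawski1990, §4.1 (4.1.2) p. 39] -/
theorem kottwitzSign_coe_out_mk_archLocal (x : archLocal L 3 (diagonal α) w) :
    kottwitzSign (starRingEnd ℂ) ((diagonal α).map w.1.embedding) (((Quotient.out (ConjClasses.mk x) : archLocal L 3 (diagonal α) w) : GL (Fin 3) ℂ) : Matrix (Fin 3) (Fin 3) ℂ) =
      kottwitzSign (starRingEnd ℂ) ((diagonal α).map w.1.embedding) ((x : GL (Fin 3) ℂ) : Matrix (Fin 3) (Fin 3) ℂ) := by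
  obtain ⟨g, hg⟩ := isConj_iff.1 (ConjClasses.mk_eq_mk_iff_isConj.1 (Quotient.out_eq (ConjClasses.mk x)))
  -- `g * out ⟦x⟧ * g⁻¹ = x` with `g ∈ G_w`
  have hmat : ((x : GL (Fin 3) ℂ) : Matrix (Fin 3) (Fin 3) ℂ) =
      ((g : GL (Fin 3) ℂ) : Matrix (Fin 3) (Fin 3) ℂ) * (((Quotient.out (ConjClasses.mk x) : archLocal L 3 (diagonal α) w) : GL (Fin 3) ℂ) : Matrix (Fin 3) (Fin 3) ℂ) *
        (((g : GL (Fin 3) ℂ)⁻¹ : GL (Fin 3) ℂ) : Matrix (Fin 3) (Fin 3) ℂ) := by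
    have h1 := congrArg (fun y : archLocal L 3 (diagonal α) w => ((y : GL (Fin 3) ℂ) : Matrix (Fin 3) (Fin 3) ℂ)) hg
    simp only [Subgroup.coe_mul, Subgroup.coe_inv, Units.val_mul] at h1
    exact h1.symm
  rw [hmat]
  exact (kottwitzSign_units_conj (σ := starRingEnd ℂ) (H := (diagonal α).map w.1.embedding) (mem_unitaryGroupOfForm_iff.mp g.2) _).symm

/-- **THE SIGNED TWO-TERM FORMULA AT A `(2,1)`-TYPE PLACE — print's «`Φ^st(γ₀, f) = Φ(γ₀, f) − Φ(γ₀′, f)`»** [Prop. 8.2.1 (d), (4.1.2), «`e(γ₀) = 1, e(γ₀′) = −1`»]: with the Kottwitz sign `e_w`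
as the class weight ON THE FUNCTION (the (ST-∞) spelling, per place), at a two-valued torus point of a place whose third weight is POSITIVE (`0 < re σ_w(α j₃)`, signature `(2,1)`):
`Φ^st_w(diag z, e_w·a) = Φ(⟦diag(z ∘ swap k ip)⟧, a) − Φ(⟦diag(z ∘ swap k im)⟧, a)`. [cite: Rogawski1990, §8.2 p. 117, Prop. 8.2.1 (d) p. 118; §4.1 (4.1.2) pp. 39–40] -/
theorem stableOrbitalIntegralRel_kottwitzSign_mul_circleDiagonal_eq_sub (hα : ∀ i, α i ≠ 0) (hreal : ∀ i, (w.1.embedding (α i)).im = 0)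
    {z : Fin 3 → Circle} {k : Fin 3} (hk : ∀ j, z j = z k ↔ j = k) (hzz : ∀ i j, i ≠ k → j ≠ k → z i = z j)
    {ip im j₃ : Fin 3} (hip : 0 < (w.1.embedding (α ip)).re) (him : (w.1.embedding (α im)).re < 0) (hj₃p : j₃ ≠ ip) (hj₃m : j₃ ≠ im)
    (hj₃ : 0 < (w.1.embedding (α j₃)).re)
    (m : OrbitalMeasureFamily (archLocal L 3 (diagonal α) w)) (a : archLocal L 3 (diagonal α) w → ℂ) :
    stableOrbitalIntegralRel (G := archLocal L 3 (diagonal α) w) (IsStablyConj (starRingEnd ℂ) ((diagonal α).map w.1.embedding)) m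
        (fun x => (((kottwitzSign (starRingEnd ℂ) ((diagonal α).map w.1.embedding) ((x : GL (Fin 3) ℂ) : Matrix (Fin 3) (Fin 3) ℂ) : ℤˣ) : ℤ) : ℂ) * a x)
        ⟨circleDiagonal 3 z, circleDiagonal_mem_archLocal_diagonal L 3 α w z⟩ =
      classOrbitalIntegral m a (ConjClasses.mk (⟨circleDiagonal 3 (z ∘ Equiv.swap k ip), circleDiagonal_mem_archLocal_diagonal L 3 α w _⟩ : archLocal L 3 (diagonal α) w)) -
        classOrbitalIntegral m a (ConjClasses.mk (⟨circleDiagonal 3 (z ∘ Equiv.swap k im), circleDiagonal_mem_archLocal_diagonal L 3 α w _⟩ : archLocal L 3 (diagonal α) w)) := by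
  -- the two signs: `e(C₊) = 1`, `e(C₋) = −1` at a `(2,1)`-type place
  have hneg : kottwitzSign (starRingEnd ℂ) ((diagonal α).map w.1.embedding)
      ((circleDiagonal 3 (z ∘ Equiv.swap k im) : GL (Fin 3) ℂ) : Matrix (Fin 3) (Fin 3) ℂ) = -1 :=
    (kottwitzSign_circleDiagonal_comp_swap_neg_eq_neg_one_iff L α w hα hreal hk hzz hip him hj₃p hj₃m).mpr hj₃
  have hpos : kottwitzSign (starRingEnd ℂ) ((diagonal α).map w.1.embedding)
      ((circleDiagonal 3 (z ∘ Equiv.swap k ip) : GL (Fin 3) ℂ) : Matrix (Fin 3) (Fin 3) ℂ) = 1 := by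
    rcases kottwitzSign_eq_one_or_eq_neg_one (σ := starRingEnd ℂ) (H := (diagonal α).map w.1.embedding)
      ((circleDiagonal 3 (z ∘ Equiv.swap k ip) : GL (Fin 3) ℂ) : Matrix (Fin 3) (Fin 3) ℂ) with h | h
    · exact h
    · exact absurd ((kottwitzSign_circleDiagonal_comp_swap_pos_eq_neg_one_iff L α w hα hreal hk hzz hip him hj₃p hj₃m).mp h) (not_lt.mpr hj₃.le)
  -- the class-weighted two-term formula at the CLASS weight `q ↦ e_w(out q)`, read back on the function by `kottwitzSign_coe_out_mk_archLocal`
  have key := stableOrbitalIntegralRel_classWeight_mul_circleDiagonal_eq_add L α w hα hreal hk hzz hip him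
    (fun q : ConjClasses (archLocal L 3 (diagonal α) w) =>
      (((kottwitzSign (starRingEnd ℂ) ((diagonal α).map w.1.embedding)
        (((Quotient.out q : archLocal L 3 (diagonal α) w) : GL (Fin 3) ℂ) : Matrix (Fin 3) (Fin 3) ℂ) : ℤˣ) : ℤ) : ℂ)) m a
  simp only [kottwitzSign_coe_out_mk_archLocal, hpos, hneg, Units.val_one, Units.val_neg, Int.cast_one, Int.cast_neg, one_mul, neg_one_mul,
    ← sub_eq_add_neg] at key
  exact key

/-- **THE SIGNED TWO-TERM FORMULA AT A `(1,2)`-TYPE PLACE** (third weight NEGATIVE): the roles swap — `Φ^st_w(diag z, e_w·a) = Φ(⟦diag(z ∘ swap k im)⟧, a) − Φ(⟦diag(z ∘ swap k ip)⟧, a)` (the class with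
`b` over the negative slot now has the INDEFINITE `a`-plane). [cite: Rogawski1990, §8.2 p. 117, Prop. 8.2.1 (d) p. 118; §4.1 (4.1.2) pp. 39–40] -/
theorem stableOrbitalIntegralRel_kottwitzSign_mul_circleDiagonal_eq_sub' (hα : ∀ i, α i ≠ 0) (hreal : ∀ i, (w.1.embedding (α i)).im = 0)
    {z : Fin 3 → Circle} {k : Fin 3} (hk : ∀ j, z j = z k ↔ j = k) (hzz : ∀ i j, i ≠ k → j ≠ k → z i = z j)
    {ip im j₃ : Fin 3} (hip : 0 < (w.1.embedding (α ip)).re) (him : (w.1.embedding (α im)).re < 0) (hj₃p : j₃ ≠ ip) (hj₃m : j₃ ≠ im)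
    (hj₃ : (w.1.embedding (α j₃)).re < 0)
    (m : OrbitalMeasureFamily (archLocal L 3 (diagonal α) w)) (a : archLocal L 3 (diagonal α) w → ℂ) :
    stableOrbitalIntegralRel (G := archLocal L 3 (diagonal α) w) (IsStablyConj (starRingEnd ℂ) ((diagonal α).map w.1.embedding)) m
        (fun x => (((kottwitzSign (starRingEnd ℂ) ((diagonal α).map w.1.embedding) ((x : GL (Fin 3) ℂ) : Matrix (Fin 3) (Fin 3) ℂ) : ℤˣ) : ℤ) : ℂ) * a x)
        ⟨circleDiagonal 3 z, circleDiagonal_mem_archLocal_diagonal L 3 α w z⟩ =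
      classOrbitalIntegral m a (ConjClasses.mk (⟨circleDiagonal 3 (z ∘ Equiv.swap k im), circleDiagonal_mem_archLocal_diagonal L 3 α w _⟩ : archLocal L 3 (diagonal α) w)) -
        classOrbitalIntegral m a (ConjClasses.mk (⟨circleDiagonal 3 (z ∘ Equiv.swap k ip), circleDiagonal_mem_archLocal_diagonal L 3 α w _⟩ : archLocal L 3 (diagonal α) w)) := by
  have hneg : kottwitzSign (starRingEnd ℂ) ((diagonal α).map w.1.embedding)
      ((circleDiagonal 3 (z ∘ Equiv.swap k ip) : GL (Fin 3) ℂ) : Matrix (Fin 3) (Fin 3) ℂ) = -1 :=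
    (kottwitzSign_circleDiagonal_comp_swap_pos_eq_neg_one_iff L α w hα hreal hk hzz hip him hj₃p hj₃m).mpr hj₃
  have hpos : kottwitzSign (starRingEnd ℂ) ((diagonal α).map w.1.embedding)
      ((circleDiagonal 3 (z ∘ Equiv.swap k im) : GL (Fin 3) ℂ) : Matrix (Fin 3) (Fin 3) ℂ) = 1 := by
    rcases kottwitzSign_eq_one_or_eq_neg_one (σ := starRingEnd ℂ) (H := (diagonal α).map w.1.embedding)
      ((circleDiagonal 3 (z ∘ Equiv.swap k im) : GL (Fin 3) ℂ) : Matrix (Fin 3) (Fin 3) ℂ) with h | h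
    · exact h
    · exact absurd ((kottwitzSign_circleDiagonal_comp_swap_neg_eq_neg_one_iff L α w hα hreal hk hzz hip him hj₃p hj₃m).mp h) (not_lt.mpr hj₃.le)
  have key := stableOrbitalIntegralRel_classWeight_mul_circleDiagonal_eq_add L α w hα hreal hk hzz hip him
    (fun q : ConjClasses (archLocal L 3 (diagonal α) w) =>
      (((kottwitzSign (starRingEnd ℂ) ((diagonal α).map w.1.embedding)
        (((Quotient.out q : archLocal L 3 (diagonal α) w) : GL (Fin 3) ℂ) : Matrix (Fin 3) (Fin 3) ℂ) : ℤˣ) : ℤ) : ℂ)) m a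
  simp only [kottwitzSign_coe_out_mk_archLocal, hpos, hneg, Units.val_one, Units.val_neg, Int.cast_one, Int.cast_neg, one_mul, neg_one_mul,
    neg_add_eq_sub] at key
  exact key

end Place

end Literature.NumberTheory.Automorphic.UnitaryGroup

end
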